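import Summits.Ventures.PercRepro.SixFourResidueThreeGenericTenB

/-!
# PercRepro — C-025 at `(6,4)`: Theorem G₃, the (α) branch of the `t = 3` clause assembled (p2, gen 9 — ruling (na)(2))

`J_three_nonneg_of_generic_le_hundred : Generic M G → 7 ≤ g ≤ 100 → 0 ≤ J₃(G)` = `ThreeGeneric` (`7 ≤ g ≤ 9`, the
profile certificate) ∪ `ThreeGenericTenB` (`g = 10`, the `U_{3,7}` accounting) ∪ `ThreeGenericTable` (`11 ≤ g ≤ 100`,
the per-pair table), unconditionally; and `J_three_nonneg_of_generic : PerPairTail → Generic M G → 7 ≤ g → 0 ≤ J₃(G)`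
for every `g`, modulo the one named obligation `PerPairTail` (the per-pair inequality for `g ≥ 101`, §21.16's two regimes —
p3's file per ruling (na)).
-/

namespace PercRepro.SixFour

/-- **The per-pair tail**: `PerPair3 g p m` for every `g ≥ 101`, `3 ≤ p ≤ g − 3`, `2 ≤ m < p` (§21.16, Regime I / II). -/
def PerPairTail : Prop := ∀ g, 101 ≤ g → ∀ p m, 3 ≤ p → p + 3 ≤ g → 2 ≤ m → m < p → PerPair3 g p m

open Finset ThmH

variable {α : Type*} [DecidableEq α] {M : Matroid α} [M.Finite] {G : Finset α}

/-- **Theorem G₃ for `7 ≤ g ≤ 100`**: `0 ≤ J₃(G)` for every generic rank-`4` set `G ⊆ E` of a simple matroid with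
`7 ≤ |G| ≤ 100` points, no bound on the planes. -/
theorem J_three_nonneg_of_generic_le_hundred (hs : Simple M) (hG : G ⊆ gr M) (hr : M.eRk (G : Set α) = 4)
    (hgen : Generic M G) (hg : 7 ≤ G.card) (hg' : G.card ≤ 100) : 0 ≤ J M G 3 := by
  rcases Nat.lt_or_ge G.card 10 with h | h
  · exact J_three_nonneg_of_generic_small hs hG hr hgen hg (by omega)
  · rcases Nat.lt_or_ge G.card 11 with h' | h'
    · exact J_three_nonneg_of_generic_ten hs hG hr hgen (by omega)
    · exact J_three_nonneg_of_generic_of_table hs hG hr hgen h' hg'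

/-- **Theorem G₃ modulo the tail**: `0 ≤ J₃(G)` for every generic rank-`4` set with `≥ 7` points, given `PerPairTail`. -/
theorem J_three_nonneg_of_generic (htail : PerPairTail) (hs : Simple M) (hG : G ⊆ gr M) (hr : M.eRk (G : Set α) = 4)
    (hgen : Generic M G) (hg : 7 ≤ G.card) : 0 ≤ J M G 3 := by
  rcases Nat.lt_or_ge G.card 101 with h | h
  · exact J_three_nonneg_of_generic_le_hundred hs hG hr hgen hg (by omega)
  · exact J_three_nonneg_of_generic_of_perPair hs hG hr hgen hg
      (fun p m hp hpg hm hmp => htail G.card h p m hp hpg hm hmp)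

end PercRepro.SixFour
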